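import HarnessLib
import Literature.Computability.AlgebraicComplexity.AlperBogartVelascoProofs
import Literature.Computability.AlgebraicComplexity.LMR13PermanentNotTangentThree

/-!
# Route `PolyaContinued`, crux `FreeEdgeAdditivity` (stmt-ValiantsHypothesis-7423) — calibration:
# squared free variables are FREE, `dc(per₃ · y² · z²) = 7 = dc(per₃)`

CALIBRATION — non-multilinear fresh monomials cost nothing in `dc`, so `FreeEdgeAdditivity`'s content is
specific to multilinear (vertex-disjoint free-edge) attachments; decides nothing about 7423
(`FreeEdgeAdditivity` NOT proved and NOT refuted); the crux is not in the
route's closes-cone (route text l.193). ROUTE-INDEPENDENT support file (no `Theses` import) (`--supports stmt-ValiantsHypothesis-7423`),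
companion of `PolyaContinuedFreeEdgeRankOne{Peel,}.lean` (free edges attached in rank one ARE
additive).

The crux `FreeEdgeAdditivity` asserts `dc(PM_G · y₁ ⋯ y_d) = dc(PM_G) + d` for FRESH, DISTINCT
(vertex-disjoint, hence multilinear) free-edge variables. This file records, in the kernel, that the
multilinearity is essential: multiplying `per₃ = PM_{K_{3,3}}` by the NON-multilinear monomial
`y² z²` in two fresh variables (degree `+4`) costs nothing,
`dc(per₃ · y² · z²) = dc(per₃) = 7` (`dc_perThree_mul_sq_mul_sq`).

Witness (`grenetYZ`): Grenet's `7 × 7` branching-program matrix of `per₃`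
(`hiGrenet7`, Hüttenhain–Ikenmeyer 2016 display (grenet7x7)) with its six unit entries — the loops
at the three singleton vertices and the three pair vertices of the program — relabelled `y` resp.
`z`. Every cycle cover of Grenet's digraph is one source cycle through exactly one singleton and one
pair vertex plus the loops at the four remaining internal vertices, so it picks up exactly `y² z²`:
`det grenetYZ = y² z² · per₃` (`det_grenetYZ`, brute Laplace expansion). Lower bound: `per₃` is the
projection `y, z ↦ 1`, so `7 = dc per₃ ≤ dc(per₃ y² z²)` (Alper–Bogart–Velasco, tree
`seven_le_determinantalComplexity_perPoly_three`; `determinantalComplexity_le_of_isProjection_holds`).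

HONEST FRAMING: a finite calibration fact about `per₃`; decides nothing about the crux (whose free
variables are distinct) and nothing about `VP ≠ VNP`.

## References

* [HuttenhainIkenmeyer2016] J. Hüttenhain, C. Ikenmeyer, *Binary determinantal complexity*, LAA 504
  (2016), §4 display (grenet7x7) (tree `hiGrenet7`, `det_hiGrenet7`).
* [AlperBogartVelasco2017] J. Alper, T. Bogart, M. Velasco, Found. Comput. Math. 17 (2017) —
  `dc per₃ = 7`.
-/

noncomputable section

-- `Summit.<Summit>.<Problem>` repeats `ValiantsHypothesis` by the tree's layout convention (D-0017).
set_option linter.dupNamespace false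

namespace Summit.ValiantsHypothesis.ValiantsHypothesis.Theorems.PolyaContinued.FreeSquares

open MvPolynomial Matrix Literature.Computability.AlgebraicComplexity
open Literature.Computability.AlgebraicComplexity.AlperBogartVelasco

variable (K : Type*) [Field K]

/-- Grenet's `7 × 7` matrix of `per₃` with the singleton-layer loops relabelled `y = X (inr 0)` and
the pair-layer loops relabelled `z = X (inr 1)`; `x_{ij} = X (inl (i,j))`. Every entry is `0` or a
single variable. [cite: HuttenhainIkenmeyer2016, §4 (grenet7x7)] -/
def grenetYZ : Matrix (Fin 7) (Fin 7) (MvPolynomial ((Fin 3 × Fin 3) ⊕ Fin 2) K) :=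
  !![X (Sum.inl (0,0)), X (Sum.inl (0,1)), X (Sum.inl (0,2)), 0, 0, 0, 0;
     X (Sum.inr 0), 0, 0, X (Sum.inl (2,1)), X (Sum.inl (2,2)), 0, 0;
     0, X (Sum.inr 0), 0, X (Sum.inl (2,0)), 0, X (Sum.inl (2,2)), 0;
     0, 0, X (Sum.inr 0), 0, X (Sum.inl (2,0)), X (Sum.inl (2,1)), 0;
     0, 0, 0, X (Sum.inr 1), 0, 0, X (Sum.inl (1,2));
     0, 0, 0, 0, X (Sum.inr 1), 0, X (Sum.inl (1,1));
     0, 0, 0, 0, 0, X (Sum.inr 1), X (Sum.inl (1,0))]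

/-- The product `per₃ · y² · z²` in the variables `(Fin 3 × Fin 3) ⊕ Fin 2`. -/
def perThreeSqSq : MvPolynomial ((Fin 3 × Fin 3) ⊕ Fin 2) K :=
  rename Sum.inl (perPoly (Fin 3) K) * X (Sum.inr 0) ^ 2 * X (Sum.inr 1) ^ 2

-- brute-force Laplace expansion of a sparse `7 × 7` determinant (four row expansions down to
-- `det_fin_three`); every step is cheap but there are a few hundred of them.
set_option maxHeartbeats 4000000 in
/-- **`det grenetYZ = y² z² · per₃`.** [folklore] -/
theorem det_grenetYZ : (grenetYZ K).det = perThreeSqSq K := by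
  have hper : rename (Sum.inl : Fin 3 × Fin 3 → (Fin 3 × Fin 3) ⊕ Fin 2) (perPoly (Fin 3) K) =
      X (Sum.inl (0,0)) * (X (Sum.inl (1,1)) * X (Sum.inl (2,2)) + X (Sum.inl (1,2)) * X (Sum.inl (2,1)))
      + X (Sum.inl (0,1)) * (X (Sum.inl (1,0)) * X (Sum.inl (2,2)) + X (Sum.inl (1,2)) * X (Sum.inl (2,0)))
      + X (Sum.inl (0,2)) * (X (Sum.inl (1,0)) * X (Sum.inl (2,1)) + X (Sum.inl (1,1)) * X (Sum.inl (2,0))) := by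
    rw [perPoly_fin_three]
    simp only [map_add, map_mul, rename_X]
  rw [perThreeSqSq, hper, Matrix.det_succ_row_zero]
  simp [grenetYZ, Fin.sum_univ_succ, Matrix.det_succ_row_zero, Matrix.submatrix_apply,
    Fin.succAbove]
  ring

/-- Every entry of `grenetYZ` is `0` or a variable, hence affine. [folklore] -/
theorem totalDegree_grenetYZ_le_one (i j : Fin 7) : ((grenetYZ K) i j).totalDegree ≤ 1 := by
  fin_cases i <;> fin_cases j <;> simp [grenetYZ, totalDegree_X]

/-- Upper bound: `dc(per₃ y² z²) ≤ 7` by the explicit matrix. [folklore] -/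
theorem dc_perThreeSqSq_le : determinantalComplexity (perThreeSqSq K) ≤ 7 :=
  determinantalComplexity_le_of_hasDetRepr ⟨grenetYZ K, totalDegree_grenetYZ_le_one K, det_grenetYZ K⟩

/-- `per₃` is the projection `y, z ↦ 1` of `per₃ y² z²`. [folklore] -/
theorem isProjection_perPoly_perThreeSqSq : IsProjection (perPoly (Fin 3) K) (perThreeSqSq K) := by
  refine ⟨Sum.elim X (fun _ => C 1), fun v => ?_, ?_⟩
  · rcases v with v | v
    · exact Or.inl ⟨v, rfl⟩
    · exact Or.inr ⟨1, rfl⟩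
  · rw [perThreeSqSq, map_mul, map_mul, map_pow, map_pow, aeval_X, aeval_X, Sum.elim_inr,
      Sum.elim_inr, aeval_rename]
    have hid : ((Sum.elim X fun _ : Fin 2 => C 1 : (Fin 3 × Fin 3) ⊕ Fin 2 → MvPolynomial (Fin 3 × Fin 3) K)
        ∘ Sum.inl) = X := by
      funext v; rfl
    rw [hid, aeval_X_left, AlgHom.id_apply]
    simp

/-- **`dc(per₃ · y² · z²) = 7`** over any field with `2 ≠ 0`: squared free variables are free for
`per₃` (whereas a single free edge attached in rank one costs `1`,
`PolyaContinuedFreeEdgeRankOne.lean`). [folklore] -/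
theorem dc_perThreeSqSq (h2 : (2 : K) ≠ 0) : determinantalComplexity (perThreeSqSq K) = 7 := by
  refine le_antisymm (dc_perThreeSqSq_le K) ?_
  exact (seven_le_determinantalComplexity_perPoly_three K h2).trans
    (determinantalComplexity_le_of_isProjection_holds (isProjection_perPoly_perThreeSqSq K))

/-- The complex instance, in the crux's spirit: `dc(PM_{K₃,₃} · y² · z²) = dc(PM_{K₃,₃}) = 7` —
no additivity for NON-multilinear free monomials. [folklore] -/
theorem dc_perThree_mul_sq_mul_sq :
    determinantalComplexity (perThreeSqSq ℂ) = determinantalComplexity (perPoly (Fin 3) ℂ) := by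
  rw [dc_perThreeSqSq ℂ two_ne_zero,
    (alperBogartVelasco2017_cor_1_4_complex alperBogartVelasco2017_cor_1_4_holds).1]

end Summit.ValiantsHypothesis.ValiantsHypothesis.Theorems.PolyaContinued.FreeSquares

end
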